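import Summits.Ventures.PercRepro0.Sharpness
import Summits.Ventures.PercRepro0.PcChi

/-!
# PM-C · CHI-CRITICAL on the cell's definitions (seat p3)

Kernel-checked twin of route/TMID-PLAN-plan-2-v1.md §3.3 (block M; context for door D7, no door
hypothesis touched): for every `d ≥ 1`, `χ_d(p_c(d)) = ∞` (`chi_pc_eq_top`), with `χ` the
susceptibility of `PcChi.lean` (`chi d p = ∑'_x P_p(0 ↔ x)` in `ℝ≥0∞`).

Proof (the plan's sketch, on p4's `φ_p(S)`). If `θ_d(p_c) > 0` then `χ = ∞` outright
(`PcChi.chi_eq_top_of_thetaI_pos`). Otherwise `p_c < 1` (as `θ_d(1) = 1`). Suppose `χ_d(p_c) < ∞`.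
The tail of the convergent sum is small: some finite `F` has `∑_{x ∉ F} τ_{p_c}(0,x) < 1/(4d)`
(`ENNReal.tendsto_tsum_compl_atTop_zero`); for `n` beyond `F`'s box, the shell `{‖x‖_∞ = n}` misses `F`,
and `φ_{p_c}(Λ_n) ≤ 2d · ∑_{‖x‖ = n} τ_{p_c}(0,x) ≤ 1/2` (only shell points have neighbours outside `Λ_n`,
at most `2d` each; `P(0 ↔_S x) ≤ τ(0,x)`; `p_c ≤ 1`) — so `φ_{p_c}(Λ_n) < 1`. Since `q ↦ φ_q(Λ_n)` is
continuous (finitely many finitely-determined events, `continuous_setBernoulli_clamp_of_determinedBy`),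
`φ_q(Λ_n) < 1` for some `q ∈ (p_c, 1)`; Theorem S1 (`Sharp.exp_decay_of_phi_lt_one`) then gives
`P_q(0 ↔ ∂Λ_m) ≤ e^{−cm}`, so `θ_d(q) = 0`, contradicting `θ_d(q) > 0` above `p_c` (L0/L1).
This is exactly «Lemma SAT» (`φ_{p_c}(S) ≥ 1` for every finite `S ∋ 0`) applied to `S = Λ_n`; the
lemma itself is `phi_pc_ge_one` below.

Inputs: S1 (p4's ClusterS/Decay), L1, L2-type continuity, S5's `chi` — all kernel-checked; no hypothesis.
Nothing here decides `T d` for any `3 ≤ d ≤ 10`.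
-/

namespace Summit.Ventures.PercRepro0.ChiCrit

open MeasureTheory ProbabilityTheory unitInterval Set Filter Topology Defs
open Summit.Ventures.PercRepro0.PcChi
open scoped ENNReal Classical

variable {d : ℕ}

/-! ### Lattice geometry: neighbours move the sup norm by at most one -/

/-- A lattice neighbour changes each coordinate by at most one. -/
theorem abs_le_abs_add_one_of_adj {x y : Vertex d} (h : (lattice d).Adj x y) (i : Fin d) :
    |y i| ≤ |x i| + 1 := by
  have hsum : (∑ j, |x j - y j|) = 1 := h
  have hi : |x i - y i| ≤ ∑ j, |x j - y j| :=
    Finset.single_le_sum (fun j _ => abs_nonneg (x j - y j)) (Finset.mem_univ i)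
  rw [hsum] at hi
  calc |y i| = |x i - (x i - y i)| := by ring_nf
    _ ≤ |x i| + |x i - y i| := abs_sub _ _
    _ ≤ |x i| + 1 := by linarith

/-- `‖y‖_∞ ≤ ‖x‖_∞ + 1` for a lattice neighbour `y` of `x`. -/
theorem nrm_le_nrm_add_one_of_adj {x y : Vertex d} (h : (lattice d).Adj x y) :
    nrm y ≤ nrm x + 1 := by
  refine Finset.sup_le fun i _ => ?_
  have h1 := abs_le_abs_add_one_of_adj h i
  have h2 := abs_le_nrm x i
  have h3 : ((y i).natAbs : ℤ) ≤ ((nrm x + 1 : ℕ) : ℤ) := by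
    rw [← Int.abs_eq_natAbs]
    push_cast
    linarith
  exact_mod_cast h3

/-- The shell `{x ∈ Λ_n : ‖x‖_∞ = n}` as a finset. -/
noncomputable def shellF (d n : ℕ) : Finset (Vertex d) := (PcChi.boxF d n).filter fun x => nrm x = n

/-- A point of `Λ_n` with a neighbour outside `Λ_n` lies on the shell. -/
theorem nrm_eq_of_outNbrs_nonempty {n : ℕ} {x : Vertex d} (hx : x ∈ PcChi.boxF d n)
    (h : (Sharp.outNbrs (↑(PcChi.boxF d n)) x).Nonempty) : nrm x = n := by
  obtain ⟨y, hy⟩ := h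
  rw [Sharp.mem_outNbrs] at hy
  have h1 : nrm y ≤ nrm x + 1 := nrm_le_nrm_add_one_of_adj hy.1
  have h2 : nrm x ≤ n := mem_boxF.1 hx
  have h3 : ¬ nrm y ≤ n := fun hle => hy.2 (Finset.mem_coe.2 (PcChi.mem_boxF.2 hle))
  omega

/-- At most `2d` neighbours. -/
theorem card_nbrs_le (x : Vertex d) : (Sharp.nbrs x).card ≤ 2 * d := by
  unfold Sharp.nbrs
  refine (Finset.card_image_le).trans ?_
  simp [Finset.card_univ, Fintype.card_prod, Fintype.card_fin, Fintype.card_bool, mul_comm]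

/-- At most `2d` neighbours outside `S`. -/
theorem card_outNbrs_le (S : Set (Vertex d)) (x : Vertex d) : (Sharp.outNbrs S x).card ≤ 2 * d :=
  (Finset.card_filter_le _ _).trans (card_nbrs_le x)

/-! ### `φ_p(Λ_n)` is bounded by the shell sum of the two-point function -/

/-- `P_p(0 ↔_S x) ≤ τ_p(0,x)`. -/
theorem P_connIn_le_P_conn (S : Set (Vertex d)) (p : I) (x : Vertex d) :
    P d p {ω : Config d | Sharp.ConnIn S ω 0 x} ≤ P d p {ω : Config d | Conn d ω 0 x} :=
  measure_mono fun _ h => Sharp.conn_of_connIn h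

/-- `φ_p(Λ_n) ≤ 2d · ∑_{‖x‖_∞ = n} τ_p(0,x)` (real numbers). -/
theorem phi_boxF_le (p : I) (n : ℕ) :
    Sharp.phi (PcChi.boxF d n) p ≤ 2 * d * ∑ x ∈ shellF d n, (P d p {ω : Config d | Conn d ω 0 x}).toReal := by
  classical
  unfold Sharp.phi
  have hp1 : (p : ℝ) ≤ 1 := p.2.2
  have hsum_nonneg : 0 ≤ ∑ x ∈ PcChi.boxF d n,
      ((Sharp.outNbrs (↑(PcChi.boxF d n)) x).card : ℝ) * (P d p {ω : Config d | Sharp.ConnIn (↑(PcChi.boxF d n)) ω 0 x}).toReal :=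
    Finset.sum_nonneg fun _ _ => mul_nonneg (Nat.cast_nonneg _) ENNReal.toReal_nonneg
  calc (p : ℝ) * ∑ x ∈ PcChi.boxF d n,
        ((Sharp.outNbrs (↑(PcChi.boxF d n)) x).card : ℝ) * (P d p {ω : Config d | Sharp.ConnIn (↑(PcChi.boxF d n)) ω 0 x}).toReal
      ≤ 1 * ∑ x ∈ PcChi.boxF d n,
        ((Sharp.outNbrs (↑(PcChi.boxF d n)) x).card : ℝ) *
          (P d p {ω : Config d | Sharp.ConnIn (↑(PcChi.boxF d n)) ω 0 x}).toReal :=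
        mul_le_mul_of_nonneg_right hp1 hsum_nonneg
    _ = ∑ x ∈ shellF d n,
        ((Sharp.outNbrs (↑(PcChi.boxF d n)) x).card : ℝ) *
          (P d p {ω : Config d | Sharp.ConnIn (↑(PcChi.boxF d n)) ω 0 x}).toReal := by
        rw [one_mul, shellF, Finset.sum_filter]
        refine Finset.sum_congr rfl fun x hx => ?_
        by_cases hn : nrm x = n
        · simp [hn]
        · have hempty : Sharp.outNbrs (↑(PcChi.boxF d n)) x = ∅ := by
            by_contra hne
            exact hn (nrm_eq_of_outNbrs_nonempty hx (Finset.nonempty_iff_ne_empty.2 hne))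
          simp [hn, hempty]
    _ ≤ ∑ x ∈ shellF d n, (2 * d : ℝ) * (P d p {ω : Config d | Conn d ω 0 x}).toReal := by
        refine Finset.sum_le_sum fun x _ => ?_
        refine mul_le_mul ?_ ?_ ENNReal.toReal_nonneg (by positivity)
        · exact_mod_cast card_outNbrs_le _ x
        · exact ENNReal.toReal_mono (measure_ne_top _ _) (P_connIn_le_P_conn _ p x)
    _ = 2 * d * ∑ x ∈ shellF d n, (P d p {ω : Config d | Conn d ω 0 x}).toReal := by
        rw [Finset.mul_sum]

/-! ### The tail of a finite susceptibility -/

/-- If `χ_d(p) < ∞` then the shell sums `∑_{‖x‖_∞ = n} τ_p(0,x)` are eventually `< ε` (in `ℝ≥0∞`). -/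
theorem exists_shell_sum_lt (p : I) (hχ : chi d p ≠ ⊤) {ε : ℝ≥0∞} (hε : 0 < ε) :
    ∃ N : ℕ, ∀ n, N ≤ n → ∑ x ∈ shellF d n, P d p {ω : Config d | Conn d ω 0 x} < ε := by
  classical
  have hχ' : ∑' x : Vertex d, P d p {ω : Config d | Conn d ω 0 x} ≠ ⊤ := hχ
  have htail := ENNReal.tendsto_tsum_compl_atTop_zero hχ'
  obtain ⟨F, hF⟩ := (htail.eventually (gt_mem_nhds hε)).exists_forall_of_atTop
  refine ⟨F.sup nrm + 1, fun n hn => ?_⟩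
  have hdisj : ∀ x ∈ shellF d n, x ∉ F := by
    intro x hx hxF
    have h1 : nrm x = n := (Finset.mem_filter.1 hx).2
    have h2 : nrm x ≤ F.sup nrm := Finset.le_sup (f := nrm) hxF
    omega
  calc ∑ x ∈ shellF d n, P d p {ω : Config d | Conn d ω 0 x}
      = ∑ b ∈ (shellF d n).subtype (fun x => x ∉ F), P d p {ω : Config d | Conn d ω 0 b} :=
        (Finset.sum_subtype_of_mem _ hdisj).symm
    _ ≤ ∑' b : {x // x ∉ F}, P d p {ω : Config d | Conn d ω 0 b} := ENNReal.sum_le_tsum _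
    _ < ε := hF F le_rfl

/-! ### `φ` is continuous in `p`; `φ < 1` kills `θ` -/

/-- `r ↦ φ_{clamp r}(S)` is continuous (finitely many finitely-determined events). -/
theorem continuous_phi_clamp (S : Finset (Vertex d)) :
    Continuous fun r : ℝ => Sharp.phi S (clamp r) := by
  unfold Sharp.phi
  refine Continuous.mul ?_ (continuous_finsetSum _ fun x _ => Continuous.mul continuous_const ?_)
  · exact continuous_subtype_val.comp (continuous_projIcc (h := zero_le_one))
  · exact continuous_setBernoulli_clamp_of_determinedBy (bonds d) (Sharp.bondsIn_finite S.finite_toSet)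
      (Sharp.measurableSet_connIn S.finite_toSet 0 x) (Sharp.determinedBy_connIn (↑S) 0 x)

/-- Theorem S1 consequence: `φ_q(S) < 1` for a finite `S ∋ 0` and `q < 1` forces `θ_d(q) = 0`. -/
theorem thetaI_eq_zero_of_phi_lt_one (q : I) (hq1 : (q : ℝ) < 1) (S : Finset (Vertex d))
    (hS0 : (0 : Vertex d) ∈ S) (hphi : Sharp.phi S q < 1) : thetaI d q = 0 := by
  obtain ⟨L, hL, hSL⟩ := Sharp.exists_box_bound S
  obtain ⟨c, hc, hdecay⟩ := Sharp.exp_decay_of_phi_lt_one q hq1 S hS0 hL hSL hphi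
  refine le_antisymm ?_ (thetaI_nonneg d q)
  have hlim : Tendsto (fun m : ℕ => Real.exp (-(c * m))) atTop (𝓝 0) := by
    have h1 : Tendsto (fun m : ℕ => c * (m : ℝ)) atTop atTop :=
      tendsto_natCast_atTop_atTop.const_mul_atTop hc
    exact Real.tendsto_exp_neg_atTop_nhds_zero.comp h1
  refine ge_of_tendsto hlim ?_
  filter_upwards [eventually_ge_atTop 1] with m hm
  exact (thetaI_le_P_toBoundary q m).trans (hdecay m hm)

/-- **Lemma SAT** (TMID-census §5): for `d ≥ 1` with `p_c(d) < 1`, every finite `S ∋ 0` has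
`φ_{p_c}(S) ≥ 1` — otherwise, by continuity, `φ_q(S) < 1` for some `q ∈ (p_c, 1)`, whence `θ_d(q) = 0`,
contradicting `θ_d(q) > 0` above `p_c`. -/
theorem one_le_phi_pc (hd : 1 ≤ d) (hpc1 : pc d < 1) (S : Finset (Vertex d))
    (hS0 : (0 : Vertex d) ∈ S) : 1 ≤ Sharp.phi S (clamp (pc d)) := by
  by_contra hlt
  have hlt' : Sharp.phi S (clamp (pc d)) < 1 := not_le.1 hlt
  have hcont := (continuous_phi_clamp (d := d) S).continuousAt (x := pc d)
  obtain ⟨δ, hδ, hδ'⟩ := Metric.continuousAt_iff.1 hcont (1 - Sharp.phi S (clamp (pc d)))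
    (by linarith)
  set r : ℝ := min (pc d + δ / 2) ((pc d + 1) / 2) with hr
  have hr_gt : pc d < r := lt_min (by linarith) (by linarith)
  have hr_lt : r < 1 := (min_le_right _ _).trans_lt (by linarith)
  have hr_le : r ≤ pc d + δ / 2 := min_le_left _ _
  have hr_dist : dist r (pc d) < δ := by
    rw [Real.dist_eq, abs_lt]
    constructor <;> linarith
  have hphi_r : Sharp.phi S (clamp r) < 1 := by
    have := hδ' hr_dist
    rw [Real.dist_eq, abs_lt] at this
    linarith [this.2]
  have hq1 : ((clamp r : I) : ℝ) < 1 := by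
    rw [coe_clamp_of_mem ⟨(pc_nonneg (d := d)).trans hr_gt.le, hr_lt.le⟩]
    exact hr_lt
  have hθ0 : thetaI d (clamp r) = 0 := thetaI_eq_zero_of_phi_lt_one (clamp r) hq1 S hS0 hphi_r
  have hθpos : 0 < theta d r := theta_pos_of_pc_lt' hd hr_gt hr_lt.le
  unfold theta at hθpos
  linarith

/-- `0 ∈ Λ_n`. -/
theorem zero_mem_boxF (n : ℕ) : (0 : Vertex d) ∈ PcChi.boxF d n := by
  rw [PcChi.mem_boxF]
  exact Finset.sup_le fun i _ => by simp

/-- **PM-C · CHI-CRITICAL** (TMID-PLAN-plan-2-v1 §3.3): `χ_d(p_c(d)) = ∞` for every `d ≥ 1`. -/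
theorem chi_pc_eq_top (hd : 1 ≤ d) : chi d (clamp (pc d)) = ⊤ := by
  by_cases hθ : 0 < thetaI d (clamp (pc d))
  · exact chi_eq_top_of_thetaI_pos _ hθ
  · have hθ0 : thetaI d (clamp (pc d)) = 0 := le_antisymm (not_lt.1 hθ) (thetaI_nonneg _ _)
    have hpc1 : pc d < 1 := by
      rcases lt_or_eq_of_le (pc_le_one hd) with h | h
      · exact h
      · exfalso
        rw [h, clamp_one, thetaI_one hd] at hθ0
        exact one_ne_zero hθ0
    by_contra hχ
    have hd' : (1 : ℝ) ≤ d := by exact_mod_cast hd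
    have h4d : (4 * (d : ℝ≥0∞)) ≠ 0 := by
      have : (d : ℝ≥0∞) ≠ 0 := by exact_mod_cast (by omega : d ≠ 0)
      exact mul_ne_zero (by norm_num) this
    have h4d' : (4 * (d : ℝ≥0∞)) ≠ ⊤ := ENNReal.mul_ne_top (by norm_num) (ENNReal.natCast_ne_top d)
    have hε : (0 : ℝ≥0∞) < (4 * (d : ℝ≥0∞))⁻¹ := ENNReal.inv_pos.2 h4d'
    obtain ⟨N, hN⟩ := exists_shell_sum_lt (clamp (pc d)) hχ hε
    have hsat := one_le_phi_pc hd hpc1 (PcChi.boxF d N) (zero_mem_boxF N)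
    have hbound := phi_boxF_le (d := d) (clamp (pc d)) N
    have hshell : ∑ x ∈ shellF d N, (P d (clamp (pc d)) {ω : Config d | Conn d ω 0 x}).toReal
        < 1 / (4 * d) := by
      have h1 := hN N le_rfl
      rw [← ENNReal.toReal_sum (fun x _ => measure_ne_top _ _)]
      have h2 : ((4 * (d : ℝ≥0∞))⁻¹).toReal = 1 / (4 * d) := by
        rw [ENNReal.toReal_inv, ENNReal.toReal_mul, ENNReal.toReal_natCast, one_div]
        norm_num
      rw [← h2]
      exact ENNReal.toReal_strict_mono (ENNReal.inv_ne_top.2 h4d) h1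
    have hlt : Sharp.phi (PcChi.boxF d N) (clamp (pc d)) < 1 := by
      have h2d : (0 : ℝ) < 2 * d := by linarith
      calc Sharp.phi (PcChi.boxF d N) (clamp (pc d))
          ≤ 2 * d * ∑ x ∈ shellF d N, (P d (clamp (pc d)) {ω : Config d | Conn d ω 0 x}).toReal :=
            hbound
        _ < 2 * d * (1 / (4 * d)) := mul_lt_mul_of_pos_left hshell h2d
        _ = 1 / 2 := by field_simp; ring
        _ < 1 := by norm_num
    linarith

/-- Corollary: `p_c(d)` is not in the print's set `{p ∈ [0,1] : χ_d(p) < ∞}` (`d ≥ 1`). -/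
theorem pc_notMem_chiSet (hd : 1 ≤ d) : pc d ∉ chiSet d := by
  intro h
  exact absurd (chi_pc_eq_top hd) (ne_of_lt h.2)

end Summit.Ventures.PercRepro0.ChiCrit
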